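import Mathlib

/-!
# Half-integer power tails `∫_x^∞ dy/(y^{n+1}√y)` and tails of functions `O(1/(y²√y))`

Analysis/ODE support file (everything proved, no definitions). For the asymptotic integration of
`u'' = (ℓ(ℓ+1)/x² + W(x)) u` with a long-range perturbation `|W(x)| ≤ A/(x²√x)` (which covers the
`O(log x/x³)` far tail of the Regge–Wheeler equation in the tortoise variable) all error terms live
in the scale `x^{integer}/√x`, which — unlike the logarithmic scale — is closed under the two
operations of the method (tails `∫_x^∞` of decaying terms, primitives `∫_X^x` of growing terms).
This file records the closed forms

  `∫_{(x,∞)} dy/(y^{n+1}√y) = 2/((2n+1) xⁿ√x)`,   `∫_X^x yⁿ/√y dy = 2(xⁿ√x − Xⁿ√X)/(2n+1)`,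

(`x > 0`, resp. `0 < X ≤ x`), the corresponding integrability statements, and the consequences for
a function `F` continuous on `[X, ∞)` (`X ≥ 1`) with `|F(y)| ≤ B/(y²√y)`:
`|∫_x^∞ y F| ≤ 2B/√x` and `|∫_x^∞ F/y^{2ℓ}| ≤ 2B/((4ℓ+3) x^{2ℓ+1}√x)` for `x ≥ X`
(Hartman, *Ordinary Differential Equations*, Ch. X §1, asymptotic integration; folklore).
-/

noncomputable section

namespace Literature.Analysis.ODE

open MeasureTheory Set Filter Topology

/-! ### `yⁿ√y` and `1/(y^{n+1}√y)`: derivatives, limits, integrals -/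

/-- `d/dy (yⁿ √y) = (2n+1) yⁿ/(2√y)` for `y > 0`. [folklore] -/
theorem hasDerivAt_pow_mul_sqrt (n : ℕ) {y : ℝ} (hy : 0 < y) :
    HasDerivAt (fun y : ℝ => y ^ n * Real.sqrt y) ((2 * n + 1) * y ^ n / (2 * Real.sqrt y)) y := by
  have hs : 0 < Real.sqrt y := Real.sqrt_pos.2 hy
  have h1 : HasDerivAt (fun y : ℝ => y ^ n) ((n : ℝ) * y ^ (n - 1)) y := hasDerivAt_pow n y
  have h2 : HasDerivAt Real.sqrt (1 / (2 * Real.sqrt y)) y := Real.hasDerivAt_sqrt hy.ne'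
  refine (h1.mul h2).congr_deriv ?_
  rcases Nat.eq_zero_or_pos n with hn | hn
  · subst hn; simp
  · have hp : y ^ (n - 1) * y = y ^ n := by
      rw [← pow_succ, Nat.sub_add_cancel hn]
    have hsq : Real.sqrt y ^ 2 = y := Real.sq_sqrt hy.le
    field_simp
    rw [hsq]
    linear_combination (2 * (n : ℝ)) * hp

/-- The primitive of `1/(y^{n+1}√y)`: `d/dy [−2/((2n+1) yⁿ√y)] = 1/(y^{n+1}√y)` (`y > 0`). [folklore] -/
theorem hasDerivAt_sqrtTail_primitive (n : ℕ) {y : ℝ} (hy : 0 < y) :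
    HasDerivAt (fun y : ℝ => -2 / ((2 * n + 1) * (y ^ n * Real.sqrt y)))
      (1 / (y ^ (n + 1) * Real.sqrt y)) y := by
  have hs : 0 < Real.sqrt y := Real.sqrt_pos.2 hy
  have hne : y ^ n * Real.sqrt y ≠ 0 := by positivity
  have hn : (2 * (n : ℝ) + 1) ≠ 0 := by positivity
  have h := ((hasDerivAt_pow_mul_sqrt n hy).inv hne).const_mul ((-2 : ℝ) / (2 * n + 1))
  have e : (fun y : ℝ => -2 / ((2 * n + 1) * (y ^ n * Real.sqrt y)))
      = fun y => (-2 : ℝ) / (2 * n + 1) * (y ^ n * Real.sqrt y)⁻¹ := by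
    funext y
    rw [mul_inv, div_eq_mul_inv, div_eq_mul_inv, mul_inv]
    ring
  rw [e]
  refine h.congr_deriv ?_
  have hsq : Real.sqrt y ^ 2 = y := Real.sq_sqrt hy.le
  field_simp
  rw [hsq]
  ring

/-- `yⁿ √y → ∞`. [folklore] -/
theorem tendsto_pow_mul_sqrt_atTop (n : ℕ) :
    Tendsto (fun y : ℝ => y ^ n * Real.sqrt y) atTop atTop := by
  refine tendsto_atTop_mono' atTop ?_ Real.tendsto_sqrt_atTop
  filter_upwards [eventually_ge_atTop (1 : ℝ)] with y hy
  have : (1 : ℝ) ≤ y ^ n := one_le_pow₀ hy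
  nlinarith [Real.sqrt_nonneg y]

/-- The primitive tends to `0` at `∞`. [folklore] -/
theorem tendsto_sqrtTail_primitive_atTop (n : ℕ) :
    Tendsto (fun y : ℝ => -2 / ((2 * n + 1) * (y ^ n * Real.sqrt y))) atTop (𝓝 0) := by
  have h1 : Tendsto (fun y : ℝ => (2 * n + 1) * (y ^ n * Real.sqrt y)) atTop atTop :=
    (tendsto_pow_mul_sqrt_atTop n).const_mul_atTop (by positivity)
  exact tendsto_const_nhds.div_atTop h1

/-- **Integrability of the half-integer power tail** `1/(y^{n+1}√y)` on `(x, ∞)`, `x > 0`. [folklore] -/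
theorem integrableOn_sqrtTail (n : ℕ) {x : ℝ} (hx : 0 < x) :
    IntegrableOn (fun y : ℝ => 1 / (y ^ (n + 1) * Real.sqrt y)) (Ioi x) :=
  integrableOn_Ioi_deriv_of_nonneg' (fun y hy => hasDerivAt_sqrtTail_primitive n (hx.trans_le hy))
    (fun y hy => by have := hx.trans hy; positivity) (tendsto_sqrtTail_primitive_atTop n)

/-- **Closed form of the half-integer power tail**: `∫_{(x,∞)} dy/(y^{n+1}√y) = 2/((2n+1) xⁿ√x)`
(`x > 0`). [folklore] -/
theorem integral_sqrtTail (n : ℕ) {x : ℝ} (hx : 0 < x) :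
    ∫ y in Ioi x, 1 / (y ^ (n + 1) * Real.sqrt y) = 2 / ((2 * n + 1) * (x ^ n * Real.sqrt x)) := by
  rw [integral_Ioi_of_hasDerivAt_of_tendsto' (fun y hy => hasDerivAt_sqrtTail_primitive n
    (hx.trans_le hy)) (integrableOn_sqrtTail n hx) (tendsto_sqrtTail_primitive_atTop n)]
  ring

/-- **The growing primitive**: `∫_X^x yⁿ/√y dy = 2(xⁿ√x − Xⁿ√X)/(2n+1)` for `0 < X ≤ x`. [folklore] -/
theorem integral_pow_div_sqrt (n : ℕ) {X x : ℝ} (hX : 0 < X) (hx : X ≤ x) :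
    ∫ y in X..x, y ^ n / Real.sqrt y
      = 2 * (x ^ n * Real.sqrt x - X ^ n * Real.sqrt X) / (2 * n + 1) := by
  have hderiv : ∀ y ∈ uIcc X x, HasDerivAt (fun y : ℝ => 2 * (y ^ n * Real.sqrt y) / (2 * n + 1))
      (y ^ n / Real.sqrt y) y := by
    intro y hy
    rw [uIcc_of_le hx] at hy
    have hy0 : 0 < y := hX.trans_le hy.1
    have hs : 0 < Real.sqrt y := Real.sqrt_pos.2 hy0
    have h := ((hasDerivAt_pow_mul_sqrt n hy0).const_mul 2).div_const (2 * (n : ℝ) + 1)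
    refine h.congr_deriv ?_
    field_simp
  have hcont : ContinuousOn (fun y : ℝ => y ^ n / Real.sqrt y) (uIcc X x) := by
    refine (continuousOn_id.pow n).div Real.continuous_sqrt.continuousOn fun y hy => ?_
    rw [uIcc_of_le hx] at hy
    exact (Real.sqrt_pos.2 (hX.trans_le hy.1)).ne'
  rw [intervalIntegral.integral_eq_sub_of_hasDerivAt hderiv (hcont.intervalIntegrable)]
  ring

/-- Bound for the growing primitive: `∫_X^x yⁿ/√y dy ≤ 2xⁿ√x/(2n+1)` for `0 < X ≤ x`. [folklore] -/
theorem integral_pow_div_sqrt_le (n : ℕ) {X x : ℝ} (hX : 0 < X) (hx : X ≤ x) :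
    ∫ y in X..x, y ^ n / Real.sqrt y ≤ 2 * (x ^ n * Real.sqrt x) / (2 * n + 1) := by
  rw [integral_pow_div_sqrt n hX hx]
  have : 0 ≤ X ^ n * Real.sqrt X := by positivity
  rw [div_le_div_iff_of_pos_right (by positivity)]
  nlinarith

/-! ### Tails of a function with `|F(y)| ≤ B/(y²√y)` -/

variable {F : ℝ → ℝ} {X B : ℝ}

/-- The constant in a bound `|F y| ≤ B/(y²√y)` at a point `y > 0` is non-negative. [folklore] -/
theorem nonneg_of_abs_le_div_sqrt {y : ℝ} (hy : 0 < y) (h : |F y| ≤ B / (y ^ 2 * Real.sqrt y)) :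
    0 ≤ B := by
  have hd : 0 < y ^ 2 * Real.sqrt y := by positivity
  rcases le_or_gt 0 B with hB | hB
  · exact hB
  · linarith [abs_nonneg (F y), div_neg_of_neg_of_pos hB hd]

/-- Integrability of `y ↦ y F(y)` on `(x, ∞)`, `x ≥ X ≥ 1`, when `F` is continuous on `[X, ∞)` with
`|F(y)| ≤ B/(y²√y)` there. [folklore] -/
theorem integrableOn_mul_of_sqrtTail (hX : 1 ≤ X) (hF : ContinuousOn F (Ici X))
    (hFB : ∀ y, X ≤ y → |F y| ≤ B / (y ^ 2 * Real.sqrt y)) {x : ℝ} (hx : X ≤ x) :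
    IntegrableOn (fun y : ℝ => y * F y) (Ioi x) := by
  have hx0 : 0 < x := lt_of_lt_of_le one_pos (hX.trans hx)
  have hmeas : AEStronglyMeasurable (fun y : ℝ => y * F y) (volume.restrict (Ioi x)) :=
    ((continuousOn_id.mul (hF.mono fun y hy => hx.trans (le_of_lt hy)))).aestronglyMeasurable
      measurableSet_Ioi
  refine Integrable.mono' (((integrableOn_sqrtTail 0 hx0).const_mul B)) hmeas ?_
  refine (ae_restrict_iff' measurableSet_Ioi).2 (Eventually.of_forall fun y hy => ?_)
  have hy : X ≤ y := hx.trans (le_of_lt hy)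
  have hy0 : 0 < y := lt_of_lt_of_le one_pos (hX.trans hy)
  have hs : 0 < Real.sqrt y := Real.sqrt_pos.2 hy0
  rw [Real.norm_eq_abs, abs_mul, abs_of_pos hy0]
  calc y * |F y| ≤ y * (B / (y ^ 2 * Real.sqrt y)) := mul_le_mul_of_nonneg_left (hFB y hy) hy0.le
    _ = B * (1 / (y ^ (0 + 1) * Real.sqrt y)) := by field_simp; ring

/-- Integrability of `y ↦ F(y)/y^{2ℓ}` on `(x, ∞)`, `x ≥ X ≥ 1`, under the same hypotheses. [folklore] -/
theorem integrableOn_div_pow_of_sqrtTail (hX : 1 ≤ X) (hF : ContinuousOn F (Ici X))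
    (hFB : ∀ y, X ≤ y → |F y| ≤ B / (y ^ 2 * Real.sqrt y)) (ℓ : ℕ) {x : ℝ} (hx : X ≤ x) :
    IntegrableOn (fun y : ℝ => F y / y ^ (2 * ℓ)) (Ioi x) := by
  have hx0 : 0 < x := lt_of_lt_of_le one_pos (hX.trans hx)
  have hmeas : AEStronglyMeasurable (fun y : ℝ => F y / y ^ (2 * ℓ)) (volume.restrict (Ioi x)) := by
    refine ContinuousOn.aestronglyMeasurable ?_ measurableSet_Ioi
    refine (hF.mono fun y hy => hx.trans (le_of_lt hy)).div (continuousOn_id.pow _) fun y hy => ?_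
    exact pow_ne_zero _ (hx0.trans hy).ne'
  refine Integrable.mono' (((integrableOn_sqrtTail (2 * ℓ + 1) hx0).const_mul B)) hmeas ?_
  refine (ae_restrict_iff' measurableSet_Ioi).2 (Eventually.of_forall fun y hy => ?_)
  have hy : X ≤ y := hx.trans (le_of_lt hy)
  have hy0 : 0 < y := lt_of_lt_of_le one_pos (hX.trans hy)
  have hs : 0 < Real.sqrt y := Real.sqrt_pos.2 hy0
  rw [Real.norm_eq_abs, abs_div, abs_of_pos (pow_pos hy0 _)]
  calc |F y| / y ^ (2 * ℓ) ≤ (B / (y ^ 2 * Real.sqrt y)) / y ^ (2 * ℓ) :=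
        div_le_div_of_nonneg_right (hFB y hy) (pow_pos hy0 _).le
    _ = B * (1 / (y ^ (2 * ℓ + 1 + 1) * Real.sqrt y)) := by field_simp; ring

/-- **First tail bound**: `|∫_{(x,∞)} y F(y) dy| ≤ 2B/√x` for `x ≥ X ≥ 1`. [folklore] -/
theorem abs_integral_mul_of_sqrtTail_le (hX : 1 ≤ X) (hF : ContinuousOn F (Ici X))
    (hFB : ∀ y, X ≤ y → |F y| ≤ B / (y ^ 2 * Real.sqrt y)) {x : ℝ} (hx : X ≤ x) :
    |∫ y in Ioi x, y * F y| ≤ 2 * B / Real.sqrt x := by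
  have hx0 : 0 < x := lt_of_lt_of_le one_pos (hX.trans hx)
  have hB : 0 ≤ B := nonneg_of_abs_le_div_sqrt (lt_of_lt_of_le one_pos hX) (hFB X le_rfl)
  calc |∫ y in Ioi x, y * F y| ≤ ∫ y in Ioi x, |y * F y| := abs_integral_le_integral_abs
    _ ≤ ∫ y in Ioi x, B * (1 / (y ^ (0 + 1) * Real.sqrt y)) := by
        refine setIntegral_mono_on (integrableOn_mul_of_sqrtTail hX hF hFB hx).abs
          ((integrableOn_sqrtTail 0 hx0).const_mul B) measurableSet_Ioi fun y hy => ?_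
        have hy' : X ≤ y := hx.trans (le_of_lt hy)
        have hy0 : 0 < y := hx0.trans hy
        have hs : 0 < Real.sqrt y := Real.sqrt_pos.2 hy0
        rw [abs_mul, abs_of_pos hy0]
        calc y * |F y| ≤ y * (B / (y ^ 2 * Real.sqrt y)) :=
              mul_le_mul_of_nonneg_left (hFB y hy') hy0.le
          _ = B * (1 / (y ^ (0 + 1) * Real.sqrt y)) := by field_simp; ring
    _ = B * ∫ y in Ioi x, 1 / (y ^ (0 + 1) * Real.sqrt y) := integral_const_mul _ _
    _ = B * (2 / ((2 * (0 : ℕ) + 1) * (x ^ 0 * Real.sqrt x))) := by rw [integral_sqrtTail 0 hx0]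
    _ = 2 * B / Real.sqrt x := by simp; ring

/-- **Second tail bound**: `|∫_{(x,∞)} F(y)/y^{2ℓ} dy| ≤ 2B/((4ℓ+3) x^{2ℓ+1}√x)` for `x ≥ X ≥ 1`. [folklore] -/
theorem abs_integral_div_pow_of_sqrtTail_le (hX : 1 ≤ X) (hF : ContinuousOn F (Ici X))
    (hFB : ∀ y, X ≤ y → |F y| ≤ B / (y ^ 2 * Real.sqrt y)) (ℓ : ℕ) {x : ℝ} (hx : X ≤ x) :
    |∫ y in Ioi x, F y / y ^ (2 * ℓ)| ≤ 2 * B / ((4 * ℓ + 3) * (x ^ (2 * ℓ + 1) * Real.sqrt x)) := by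
  have hx0 : 0 < x := lt_of_lt_of_le one_pos (hX.trans hx)
  have hB : 0 ≤ B := nonneg_of_abs_le_div_sqrt (lt_of_lt_of_le one_pos hX) (hFB X le_rfl)
  calc |∫ y in Ioi x, F y / y ^ (2 * ℓ)| ≤ ∫ y in Ioi x, |F y / y ^ (2 * ℓ)| :=
        abs_integral_le_integral_abs
    _ ≤ ∫ y in Ioi x, B * (1 / (y ^ (2 * ℓ + 1 + 1) * Real.sqrt y)) := by
        refine setIntegral_mono_on (integrableOn_div_pow_of_sqrtTail hX hF hFB ℓ hx).abs
          ((integrableOn_sqrtTail (2 * ℓ + 1) hx0).const_mul B) measurableSet_Ioi fun y hy => ?_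
        have hy' : X ≤ y := hx.trans (le_of_lt hy)
        have hy0 : 0 < y := hx0.trans hy
        have hs : 0 < Real.sqrt y := Real.sqrt_pos.2 hy0
        rw [abs_div, abs_of_pos (pow_pos hy0 _)]
        calc |F y| / y ^ (2 * ℓ) ≤ (B / (y ^ 2 * Real.sqrt y)) / y ^ (2 * ℓ) :=
              div_le_div_of_nonneg_right (hFB y hy') (pow_pos hy0 _).le
          _ = B * (1 / (y ^ (2 * ℓ + 1 + 1) * Real.sqrt y)) := by field_simp; ring
    _ = B * ∫ y in Ioi x, 1 / (y ^ (2 * ℓ + 1 + 1) * Real.sqrt y) := integral_const_mul _ _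
    _ = B * (2 / ((2 * ((2 * ℓ + 1 : ℕ) : ℝ) + 1) * (x ^ (2 * ℓ + 1) * Real.sqrt x))) := by
        rw [integral_sqrtTail (2 * ℓ + 1) hx0]
    _ = 2 * B / ((4 * ℓ + 3) * (x ^ (2 * ℓ + 1) * Real.sqrt x)) := by push_cast; ring

end Literature.Analysis.ODE
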